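import Summits.Ventures.PercRepro.ExcessOneNonTightening

/-!
# Members through a non-tightening direction, joined with the addable part ((NW) of Addendum 38)

Dossier proofs/MINE1-theoremS.md, Addendum 38 §2, Lemma (NW)(ii), and proofs/MINE1-RSTARM-PROOF.md
§3 (NW) and §5 (iii). At a non-tightening direction `a` of a family `F` with nonempty partner
family `K = partner a F` (Theorem (NT), ExcessOneNonTightening.lean), every member `y ∋ a` has
`y ∪ R ∈ F` with `R = Rstar K` the addable part of `K` — this is `union_Rstar_mem_partner` applied
to `y.erase a ∈ partr a F`. Consequently, if no member of `F` contains a set `u`, then no member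
through `a` contains `u \ R`: the sets `u \ R` — in the instance `u \ ρ_m ⊆ W = u \ I` — are
never covered by the members through `a`. In Theorem (R*-M) this is used twice: no member of `T`
contains `W` ((NW)(iii)), and the set `W^* = u \ ρ^*` lies below no outside trace (Addendum 39,
Step 1 (1c)), which is what makes `g ↦ g ∆ ρ^*` land in `T_u` (MSTightBlockInjection.lean).
-/

namespace PercRepro.MSTight

open Finset
open scoped FinsetFamily

variable {α : Type*} [DecidableEq α] [Fintype α] {a : α} {F : Finset (Finset α)}

/-- At a non-tightening direction `a` with nonempty partner family, every member `y ∋ a` joined with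
the addable part `R = Rstar (partner a F)` is again a member. -/
theorem union_Rstar_mem_of_mem (hε : (diffsX a F ∩ diffsY a F).card = (partner a F).card)
    (hK : (partner a F).Nonempty) {y : Finset α} (hy : y ∈ F) (hay : a ∈ y) :
    y ∪ Rstar (partner a F) ∈ F := by
  have ht : y.erase a ∈ partr a F :=
    mem_partr.2 ⟨notMem_erase a y, by rw [insert_erase hay]; exact hy⟩
  have h := insert_mem_of_mem_partner (union_Rstar_mem_partner hε hK ht)
  have e : insert a (y.erase a ∪ Rstar (partner a F)) = y ∪ Rstar (partner a F) := by
    rw [← insert_union, insert_erase hay]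
  rwa [e] at h

/-- **(NW)(ii).** If no member of `F` contains `u`, then no member through a non-tightening
direction `a` (with nonempty partner family) contains `u \ Rstar (partner a F)`. -/
theorem not_sdiff_Rstar_subset_of_mem (hε : (diffsX a F ∩ diffsY a F).card = (partner a F).card)
    (hK : (partner a F).Nonempty) {u : Finset α} (hu : ∀ z ∈ F, ¬ u ⊆ z)
    {y : Finset α} (hy : y ∈ F) (hay : a ∈ y) : ¬ u \ Rstar (partner a F) ⊆ y := by
  intro hsub
  apply hu _ (union_Rstar_mem_of_mem hε hK hy hay)
  intro x hx
  by_cases hxR : x ∈ Rstar (partner a F)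
  · exact mem_union_right _ hxR
  · exact mem_union_left _ (hsub (mem_sdiff.2 ⟨hx, hxR⟩))

/-- The trace form used in Addendum 39 (1c): if no member contains `u`, a member `y ∋ a` never
contains `u \ (u ∩ Rstar (partner a F))`. -/
theorem not_sdiff_inter_Rstar_subset_of_mem
    (hε : (diffsX a F ∩ diffsY a F).card = (partner a F).card)
    (hK : (partner a F).Nonempty) {u : Finset α} (hu : ∀ z ∈ F, ¬ u ⊆ z)
    {y : Finset α} (hy : y ∈ F) (hay : a ∈ y) : ¬ u \ (u ∩ Rstar (partner a F)) ⊆ y := by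
  rw [sdiff_inter_self_left]
  exact not_sdiff_Rstar_subset_of_mem hε hK hu hy hay

end PercRepro.MSTight
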